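import Summits.BirchSwinnertonDyer.BirchSwinnertonDyer.Theorems.ByReductionTypeAtTwoOrdKatoHalfAtTwoIsoColemanMuSpanFreeKatoCarriers
import Summits.BirchSwinnertonDyer.BirchSwinnertonDyer.Theorems.ByReductionTypeAtTwoAnalyticMuZeroShapes
import Literature.NumberTheory.EllipticCurves.Kato2004.LocalIwasawaCohomologyTateDuality
import Literature.NumberTheory.EllipticCurves.PAdicLFunctionIntegralityAtTwoAutoProofs
import Literature.NumberTheory.EllipticCurves.PAdicLFunctionNeZeroHoldsProofs
import Literature.NumberTheory.EllipticCurves.IwasawaAlgebraProofs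
import HarnessLib

/-!
# Route ByReductionTypeAtTwo, crux `OrdKatoHalfAtTwoIso` (stmt-BirchSwinnertonDyer-19573), line `steinberg-fibre-at-two`,
# F1 slot (child stmt-BirchSwinnertonDyer-24097): the two registered memo stubs W2⁻ / W2⁺ of skeleton v21
# (`stub_colemanERL_negDisc_two`, `stub_colemanHalf_posDisc_two`) are EQUIVALENT, in the kernel, to VALUE-ONLY
# μ-statements — «an ordinary-kernel functional `col` on `𝐇¹_{loc,Γ}(T₂W)` and a (genuine) class of `𝐇¹_Γ(T₂W)` whose
# `col ∘ loc₂`-value is NOT divisible by `2`» — in which the `2`-adic `L`-function, the period unit `r` and the cofactor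
# `M` no longer occur

Seat `cruxlead-stmt-BirchSwinnertonDyer-19573-w3` g5 (prover WIDTH under the LEAD `cruxlead-19573`; HOME `run/shared/lean/pub/bsd-2adic/`;
`--supports` stmt-BirchSwinnertonDyer-24097). THEOREMS ONLY (no definition, no named fact, no `sorry`, no instance). HONEST FRAMING (cell
bsd-2adic): BSD is not proved by any of this; F1μι⁻, P⁺, the children and the crux are NOT proved here; the value-only texts V⁻ / V⁺
below are displayed HYPOTHESES (memo tier, exactly as strong as the registered W2⁻ / W2⁺ on their cells — both directions are proved),
NOT definitions and NOT Literature facts.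

WHY (the lead g9's «honest pricing» note of v21, made a kernel theorem). The registered texts ask, per cell datum, for a `Λ`-linear
`col : J.H → Λ` with `ker col ≤ range(J′ → J)` and a class `g` (GENUINE on `Δ < 0`; any global class `y` on `0 < Δ`) with
`col (loc g) = u·M·L′`, `u ∈ Λˣ`, `M ∉ (2)`, `ι L′ = C r·L₂(f, α)`, `‖r‖₂ = 1`. Since `col` may be RESCALED inside the text by any
non-zero `λ ∈ Λ` without moving its kernel (`Λ = ℤ₂⟦X⟧` is a domain), and since on the cells (`ρ̄_{W,2}` onto, good ordinary at `2`)
the tree PROVES `L₂(f, α) ∈ ι(Λ)` (INT2-AUTO, `exists_iwasawaToPowerSeries_eq_padicLFunction_two_auto`), `L₂(f, α) ≠ 0` (Rohrlich,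
`padicLFunction_unitRoot_ne_zero`) and `μ(L₂(f, α)) = 0` (`AnalyticMuTwo.exists_norm_coeff_padicLFunction_two_eq_one_of_surj`), the value
clause is equivalent to `col (loc g) ∉ (2)`:
* (⇐) rescale `col` by the integral lift `L′ := ι⁻¹ L₂(f, α)` (`r = 1`, `u = 1`, `M := col (loc g)`);
* (⇒) `(2) = augIdealP 2` is prime (`isPrime_augIdealP_holds`), `u·M ∉ (2)`, and `L′ ∉ (2)` because `ι L′ = C r·L₂` has a coefficient
  of norm `‖r‖·1 = 1` while every coefficient of `ι` of an element of `(2)` has norm `≤ ½`.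
So the memo content of W2∓ is «∃ ordinary-kernel functional with a `μ`-free value on a (genuine) class»; the explicit reciprocity law
enters only through the `μ`-invariant of that value. (The KERNEL clause `∃ col, ker col = range(J′ → J)` is a separate matter — local
Iwasawa theory at the ordinary prime; not touched here.)

* §1 algebra at any prime `p`: `ker_smul_col_le`, `notMem_augIdealP_of_map_eq_C_mul`, `mul_notMem_augIdealP`,
  `exists_rescaled_col_of_notMem_augIdealP`, `notMem_augIdealP_of_colemanValue`.
* §2 the texts: `colemanERL_negDisc_two_of_muFreeValue` / `muFreeValue_of_colemanERL_negDisc_two` / `colemanERL_negDisc_two_iff_muFreeValue`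
  (cell `Δ < 0`, genuine class) and `colemanHalf_posDisc_two_of_muFreeValue` / `muFreeValue_of_colemanHalf_posDisc_two` /
  `colemanHalf_posDisc_two_iff_muFreeValue` (cell `0 < Δ`).
* §3 doors BY NAME: `zetaColemanMuIotaNegDiscAtTwo_of_tateDuality_of_muFreeValue` (F1μι⁻ = conjunct 1 of child 24097 from the Literature
  fact `Kato2004.exists_lambdaAdicLocalTatePairing_selmer_orthogonal` at `2` + V⁻, through w3 g3's p720644) and
  `colemanMuSpanFreeIotaPosDiscAtTwo_of_tateDuality_of_muFreeValue` (P⁺ from the same fact + V⁺, through the lead g9's p723623).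

References: [Kato2004Asterisque] Thm 12.6 (p. 222), Thm 16.6 (2) (p. 271), Prop 17.11 (p. 277), §17.13 (pp. 279–280) (shape of W2);
[MazurTateTeitelbaum1986Invent] §I.12 (`Λ ↪ ℚ_p⟦T⟧`); [RohrlichInventiones1984] Theorem p. 409; [Washington1997] §13.1 (`(p)` prime in `Λ`);
[GreenbergLNM1716] Conj. 1.11 (shape); tree p720644 `…ZetaColemanMuIotaKatoCarriers`, p723623 `…ColemanMuSpanFreeKatoCarriers`, p723619
`Kato2004/LocalIwasawaCohomologyTateDuality`.
-/

set_option autoImplicit false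
set_option linter.dupNamespace false

noncomputable section

open scoped Classical MatrixGroups ModularForm NumberField
open CongruenceSubgroup WeierstrassCurve Field IsDedekindDomain NumberField
open Literature.NumberTheory.GaloisRepresentations
open Literature.NumberTheory.GaloisCohomology
open Literature.NumberTheory.EllipticCurves Literature.NumberTheory.EllipticCurves.ModularForms
  Literature.NumberTheory.EllipticCurves.GreenbergSelmer
open Literature.NumberTheory.EllipticCurves.Kato2004
  Literature.NumberTheory.EllipticCurves.Kato2004.EulerSystemValues
open Literature.NumberTheory.EllipticCurves.IwasawaDual
open Literature.NumberTheory.EllipticCurves.Rank1Residual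
open Literature.NumberTheory.EllipticCurves.Greenberg1999
open Summit.BirchSwinnertonDyer.Rank1Residual Summit.BirchSwinnertonDyer.Rank1Residual.X5
open Summit.BirchSwinnertonDyer.BirchSwinnertonDyer.Theses.ByReductionTypeAtTwo

namespace Summit.BirchSwinnertonDyer.BirchSwinnertonDyer.Theorems.SteinbergFibreAtTwo

/-! ## §1 Algebra in `Λ = ℤ_p⟦X⟧` (any prime `p`): rescaling a functional, and the prime `(p)` -/

section Algebra

variable {p : ℕ} [Fact p.Prime]

/-- Rescaling a `Λ`-valued functional by a NON-ZERO scalar does not enlarge its kernel (`Λ = ℤ_p⟦X⟧` is a domain): if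
`ker col ≤ S` then `ker (c • col) ≤ S`. [folklore] -/
theorem ker_smul_col_le {H : Type*} [AddCommGroup H] [Module (IwasawaAlgebra p) H]
    (S : Submodule (IwasawaAlgebra p) H) (col : H →ₗ[IwasawaAlgebra p] IwasawaAlgebra p)
    (hker : ∀ x : H, col x = 0 → x ∈ S) {c : IwasawaAlgebra p} (hc : c ≠ 0) :
    ∀ x : H, (c • col) x = 0 → x ∈ S := by
  intro x hx
  rw [LinearMap.smul_apply, smul_eq_mul, mul_eq_zero] at hx
  exact hker x (hx.resolve_left hc)

/-- An element `L′ ∈ Λ` whose image in `ℚ_p⟦T⟧` is `C r · L` with `‖r‖ = 1` and `L` having SOME coefficient of norm `1`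
(`μ(L) = 0` in the analytic normalisation) does not lie in `(p)`: every coefficient of `ι` of an element of `(p)` has norm
`≤ ‖p‖ < 1`. [cite: Washington1997, §13.1] [cite: MazurTateTeitelbaum1986Invent, §I.12] -/
theorem notMem_augIdealP_of_map_eq_C_mul {L' : IwasawaAlgebra p} {r : ℚ_[p]} {L : PowerSeries ℚ_[p]}
    (hr : ‖r‖ = 1) (hL' : iwasawaToPowerSeries p L' = PowerSeries.C r * L)
    (hμ : ∃ n : ℕ, ‖PowerSeries.coeff n L‖ = 1) : L' ∉ IwasawaAlgebra.augIdealP p := by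
  intro hmem
  obtain ⟨n, hn⟩ := hμ
  rw [IwasawaAlgebra.mem_augIdealP_iff] at hmem
  obtain ⟨a, ha⟩ := hmem n
  have h1 : PowerSeries.coeff n (iwasawaToPowerSeries p L') = ((PowerSeries.coeff n L' : ℤ_[p]) : ℚ_[p]) := by
    rw [PowerSeries.coeff_map]
    rfl
  have h2 : PowerSeries.coeff n (PowerSeries.C r * L) = r * PowerSeries.coeff n L :=
    PowerSeries.coeff_C_mul n L r
  have h3 : ‖((PowerSeries.coeff n L' : ℤ_[p]) : ℚ_[p])‖ = 1 := by
    rw [← h1, hL', h2, norm_mul, hr, hn, one_mul]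
  have h4 : ‖((PowerSeries.coeff n L' : ℤ_[p]) : ℚ_[p])‖ < 1 := by
    rw [PadicInt.padic_norm_e_of_padicInt, ha, norm_mul, PadicInt.norm_p]
    have hp : (1 : ℝ) < p := by exact_mod_cast (Fact.out : p.Prime).one_lt
    calc (p : ℝ)⁻¹ * ‖a‖ ≤ (p : ℝ)⁻¹ * 1 := by gcongr; exact a.norm_le_one
      _ < 1 := by rw [mul_one]; exact inv_lt_one_of_one_lt₀ hp
  exact absurd h3 (ne_of_lt h4)

/-- A product `u·M·L′` with `u` a unit and `M, L′ ∉ (p)` does not lie in the PRIME ideal `(p) ⊂ Λ`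
(`IwasawaAlgebra.isPrime_augIdealP_holds`). [cite: Washington1997, §13.1] -/
theorem mul_notMem_augIdealP (u : (IwasawaAlgebra p)ˣ) {M L' : IwasawaAlgebra p}
    (hM : M ∉ IwasawaAlgebra.augIdealP p) (hL' : L' ∉ IwasawaAlgebra.augIdealP p) :
    (u : IwasawaAlgebra p) * M * L' ∉ IwasawaAlgebra.augIdealP p := by
  have hprime : (IwasawaAlgebra.augIdealP p).IsPrime := IwasawaAlgebra.isPrime_augIdealP_holds p
  intro hmem
  rcases hprime.mem_or_mem hmem with huM | hL
  · rcases hprime.mem_or_mem huM with hu | hM'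
    · exact hprime.ne_top (Ideal.eq_top_of_isUnit_mem _ hu u.isUnit)
    · exact hM hM'
  · exact hL' hL

/-- **Rescaling (⇐ of the value clause).** From a functional `col` with `ker col ≤ S` and a vector `x₀` with `col x₀ ∉ (p)`, and any
NON-ZERO `L′ ∈ Λ`: the rescaled functional `L′ • col` still has `ker ≤ S` and its value at `x₀` has the W2 shape `u·M·L′` with `u = 1`,
`M = col x₀ ∉ (p)`. [folklore] -/
theorem exists_rescaled_col_of_notMem_augIdealP {H : Type*} [AddCommGroup H] [Module (IwasawaAlgebra p) H]
    (S : Submodule (IwasawaAlgebra p) H) (col : H →ₗ[IwasawaAlgebra p] IwasawaAlgebra p)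
    (hker : ∀ x : H, col x = 0 → x ∈ S) (x₀ : H) (hx₀ : col x₀ ∉ IwasawaAlgebra.augIdealP p)
    {L' : IwasawaAlgebra p} (hL' : L' ≠ 0) :
    ∃ col' : H →ₗ[IwasawaAlgebra p] IwasawaAlgebra p, (∀ x : H, col' x = 0 → x ∈ S) ∧
      ∃ (u : (IwasawaAlgebra p)ˣ) (M : IwasawaAlgebra p), M ∉ IwasawaAlgebra.augIdealP p ∧
        col' x₀ = (u : IwasawaAlgebra p) * M * L' :=
  ⟨L' • col, ker_smul_col_le S col hker hL', 1, col x₀, hx₀, by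
    rw [LinearMap.smul_apply, smul_eq_mul, Units.val_one, one_mul, mul_comm]⟩

/-- **(⇒ of the value clause).** A value of the W2 shape `c = u·M·L′` with `M ∉ (p)`, `ι L′ = C r·L`, `‖r‖ = 1` and `μ(L) = 0` (some
coefficient of `L` of norm `1`) is not in `(p)`. [cite: Washington1997, §13.1] [cite: MazurTateTeitelbaum1986Invent, §I.12] -/
theorem notMem_augIdealP_of_colemanValue {c : IwasawaAlgebra p} (u : (IwasawaAlgebra p)ˣ) {M L' : IwasawaAlgebra p} {r : ℚ_[p]}
    {L : PowerSeries ℚ_[p]} (hM : M ∉ IwasawaAlgebra.augIdealP p) (hr : ‖r‖ = 1)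
    (hL' : iwasawaToPowerSeries p L' = PowerSeries.C r * L) (hμ : ∃ n : ℕ, ‖PowerSeries.coeff n L‖ = 1)
    (hc : c = (u : IwasawaAlgebra p) * M * L') : c ∉ IwasawaAlgebra.augIdealP p := by
  rw [hc]
  exact mul_notMem_augIdealP u hM (notMem_augIdealP_of_map_eq_C_mul hr hL' hμ)

end Algebra

/-! ## §2 The registered W2 texts ⟺ the value-only texts V (cell by cell; binders identical to the registered ones) -/

/-- **V⁻ ⟹ W2⁻** (`Δ < 0`, genuine class): from «∃ `col` with `ker col ≤ range(J′ → J)` and a GENUINE Euler-system class `g` with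
`col (loc g) ∉ (2)`» to the registered text of `stub_colemanERL_negDisc_two` (= `hcolERL` of p720644), by rescaling `col` with the integral
lift of `L₂(f, α)` (INT2-AUTO; non-zero by Rohrlich): `r = 1`, `u = 1`, `M = col (loc g)`. The binder lists of the two texts are identical.
[cite: MazurTateTeitelbaum1986Invent, §I.12] [cite: RohrlichInventiones1984, Theorem (p. 409)]
[cite: Kato2004Asterisque, Thm 12.6 (p. 222), Thm 16.6 (2) (p. 271), Prop 17.11 (p. 277) (shape of W2)] -/
theorem colemanERL_negDisc_two_of_muFreeValue
    (hV : ∀ (W : WeierstrassCurve ℚ) [W.IsElliptic] [W.IsGloballyMinimal]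
      [ContinuousSMul ℤ_[2] (W.tateModule 2)] [Module.Free ℤ_[2] (W.tateModule 2)] [Module.Finite ℤ_[2] (W.tateModule 2)]
      {N : ℕ} [NeZero N] (f : CuspForm (Gamma0 N) 2)
      (κ : ZpExtension ℚ 2) (γ : absoluteGaloisGroup ℚ) (hκ : κ.IsCyclotomic) (hγ : κ.IsTopGenerator γ),
      W.Δ < 0 → IsOrdinaryAt W 2 → W.HasSurjectiveModNGaloisRep 2 → IsCyclotomicVariable 2 γ → IsNewformOf W f →
      ∀ (v₂ : HeightOneSpectrum (𝓞 ℚ)) (_ : ((2 : ℕ) : 𝓞 ℚ) ∈ v₂.asIdeal)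
        (γᵥ : absoluteGaloisGroup (v₂.adicCompletion ℚ))
        (hsurj : Function.Surjective
          (κ.toContinuousMonoidHom.comp (resGalOfEmb (closureEmb (K := ℚ) (v₂.adicCompletion ℚ)))))
        (hγᵥ : κ.IsTopGenerator (resGalOfEmb (closureEmb (K := ℚ) (v₂.adicCompletion ℚ)) γᵥ))
        (I : IwasawaH1Data W 2 κ γ) (J : LocalIwasawaH1Data κ v₂ ((tateRep W 2).toLocal v₂) γᵥ)
        (J' : LocalIwasawaH1Data κ v₂ (tateLocalOrdinaryRep W 2 v₂) γᵥ),
      ∃ col : J.H →ₗ[IwasawaAlgebra 2] IwasawaAlgebra 2,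
        (∀ x : J.H, col x = 0 → x ∈ LinearMap.range (J'.ordinaryInclusion J)) ∧
        ∃ g : I.H, IsEulerSystemClassTwo W hκ I g ∧ col (I.loc J hsurj hγ hγᵥ g) ∉ IwasawaAlgebra.augIdealP 2) :
    ∀ (W : WeierstrassCurve ℚ) [W.IsElliptic] [W.IsGloballyMinimal]
      [ContinuousSMul ℤ_[2] (W.tateModule 2)] [Module.Free ℤ_[2] (W.tateModule 2)] [Module.Finite ℤ_[2] (W.tateModule 2)]
      {N : ℕ} [NeZero N] (f : CuspForm (Gamma0 N) 2)
      (κ : ZpExtension ℚ 2) (γ : absoluteGaloisGroup ℚ) (hκ : κ.IsCyclotomic) (hγ : κ.IsTopGenerator γ),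
      W.Δ < 0 → IsOrdinaryAt W 2 → W.HasSurjectiveModNGaloisRep 2 → IsCyclotomicVariable 2 γ → IsNewformOf W f →
      ∀ (v₂ : HeightOneSpectrum (𝓞 ℚ)) (_ : ((2 : ℕ) : 𝓞 ℚ) ∈ v₂.asIdeal)
        (γᵥ : absoluteGaloisGroup (v₂.adicCompletion ℚ))
        (hsurj : Function.Surjective
          (κ.toContinuousMonoidHom.comp (resGalOfEmb (closureEmb (K := ℚ) (v₂.adicCompletion ℚ)))))
        (hγᵥ : κ.IsTopGenerator (resGalOfEmb (closureEmb (K := ℚ) (v₂.adicCompletion ℚ)) γᵥ))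
        (I : IwasawaH1Data W 2 κ γ) (J : LocalIwasawaH1Data κ v₂ ((tateRep W 2).toLocal v₂) γᵥ)
        (J' : LocalIwasawaH1Data κ v₂ (tateLocalOrdinaryRep W 2 v₂) γᵥ),
      ∃ col : J.H →ₗ[IwasawaAlgebra 2] IwasawaAlgebra 2,
        (∀ x : J.H, col x = 0 → x ∈ LinearMap.range (J'.ordinaryInclusion J)) ∧
        ∃ g : I.H, IsEulerSystemClassTwo W hκ I g ∧
          ∃ (u : (IwasawaAlgebra 2)ˣ) (M L' : IwasawaAlgebra 2) (r : ℚ_[2]),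
            M ∉ IwasawaAlgebra.augIdealP 2 ∧ ‖r‖ = 1 ∧
              iwasawaToPowerSeries 2 L' = PowerSeries.C r * padicLFunction f (unitRoot W 2 : ℚ_[2]) ∧
              col (I.loc J hsurj hγ hγᵥ g) = (u : IwasawaAlgebra 2) * M * L' := by
  intro W _ _ _ _ _ N _ f κ γ hκ hγ hΔ hord h2 hγ' hf v₂ hv₂ γᵥ hsurj hγᵥ I J J'
  obtain ⟨col, hker, g, hg, hval⟩ := hV W f κ γ hκ hγ hΔ hord h2 hγ' hf v₂ hv₂ γᵥ hsurj hγᵥ I J J'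
  -- the integral lift of `L₂(f, α)` (INT2-AUTO), non-zero by Rohrlich
  obtain ⟨L', hL'⟩ := exists_iwasawaToPowerSeries_eq_padicLFunction_two_auto hord hf
  have hL'0 : L' ≠ 0 := by
    rintro rfl
    exact padicLFunction_unitRoot_ne_zero hord hf (by rw [← hL', map_zero])
  obtain ⟨col', hker', u, M, hM, hcol'⟩ :=
    exists_rescaled_col_of_notMem_augIdealP (LinearMap.range (J'.ordinaryInclusion J)) col hker
      (I.loc J hsurj hγ hγᵥ g) hval hL'0
  exact ⟨col', hker', g, hg, u, M, L', 1, hM, norm_one, by rw [map_one, one_mul, hL'], hcol'⟩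

/-- **W2⁻ ⟹ V⁻** (`Δ < 0`): the registered text implies the value-only text, because `(2)` is prime, `u·M ∉ (2)`, and `L′ ∉ (2)` by
the PROVED analytic `μ₂ = 0` on «good ordinary at `2`, `ρ̄_{W,2}` onto» (`AnalyticMuTwo.exists_norm_coeff_padicLFunction_two_eq_one_of_surj`).
So V⁻ is NOT a strengthening of W2⁻. [cite: Washington1997, §13.1] [cite: GreenbergLNM1716, §1 Conj. 1.11 (shape; the p = 2 analytic reading is the tree's theorem)] -/
theorem muFreeValue_of_colemanERL_negDisc_two
    (hcolERL : ∀ (W : WeierstrassCurve ℚ) [W.IsElliptic] [W.IsGloballyMinimal]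
      [ContinuousSMul ℤ_[2] (W.tateModule 2)] [Module.Free ℤ_[2] (W.tateModule 2)] [Module.Finite ℤ_[2] (W.tateModule 2)]
      {N : ℕ} [NeZero N] (f : CuspForm (Gamma0 N) 2)
      (κ : ZpExtension ℚ 2) (γ : absoluteGaloisGroup ℚ) (hκ : κ.IsCyclotomic) (hγ : κ.IsTopGenerator γ),
      W.Δ < 0 → IsOrdinaryAt W 2 → W.HasSurjectiveModNGaloisRep 2 → IsCyclotomicVariable 2 γ → IsNewformOf W f →
      ∀ (v₂ : HeightOneSpectrum (𝓞 ℚ)) (_ : ((2 : ℕ) : 𝓞 ℚ) ∈ v₂.asIdeal)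
        (γᵥ : absoluteGaloisGroup (v₂.adicCompletion ℚ))
        (hsurj : Function.Surjective
          (κ.toContinuousMonoidHom.comp (resGalOfEmb (closureEmb (K := ℚ) (v₂.adicCompletion ℚ)))))
        (hγᵥ : κ.IsTopGenerator (resGalOfEmb (closureEmb (K := ℚ) (v₂.adicCompletion ℚ)) γᵥ))
        (I : IwasawaH1Data W 2 κ γ) (J : LocalIwasawaH1Data κ v₂ ((tateRep W 2).toLocal v₂) γᵥ)
        (J' : LocalIwasawaH1Data κ v₂ (tateLocalOrdinaryRep W 2 v₂) γᵥ),
      ∃ col : J.H →ₗ[IwasawaAlgebra 2] IwasawaAlgebra 2,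
        (∀ x : J.H, col x = 0 → x ∈ LinearMap.range (J'.ordinaryInclusion J)) ∧
        ∃ g : I.H, IsEulerSystemClassTwo W hκ I g ∧
          ∃ (u : (IwasawaAlgebra 2)ˣ) (M L' : IwasawaAlgebra 2) (r : ℚ_[2]),
            M ∉ IwasawaAlgebra.augIdealP 2 ∧ ‖r‖ = 1 ∧
              iwasawaToPowerSeries 2 L' = PowerSeries.C r * padicLFunction f (unitRoot W 2 : ℚ_[2]) ∧
              col (I.loc J hsurj hγ hγᵥ g) = (u : IwasawaAlgebra 2) * M * L') :
    ∀ (W : WeierstrassCurve ℚ) [W.IsElliptic] [W.IsGloballyMinimal]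
      [ContinuousSMul ℤ_[2] (W.tateModule 2)] [Module.Free ℤ_[2] (W.tateModule 2)] [Module.Finite ℤ_[2] (W.tateModule 2)]
      {N : ℕ} [NeZero N] (f : CuspForm (Gamma0 N) 2)
      (κ : ZpExtension ℚ 2) (γ : absoluteGaloisGroup ℚ) (hκ : κ.IsCyclotomic) (hγ : κ.IsTopGenerator γ),
      W.Δ < 0 → IsOrdinaryAt W 2 → W.HasSurjectiveModNGaloisRep 2 → IsCyclotomicVariable 2 γ → IsNewformOf W f →
      ∀ (v₂ : HeightOneSpectrum (𝓞 ℚ)) (_ : ((2 : ℕ) : 𝓞 ℚ) ∈ v₂.asIdeal)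
        (γᵥ : absoluteGaloisGroup (v₂.adicCompletion ℚ))
        (hsurj : Function.Surjective
          (κ.toContinuousMonoidHom.comp (resGalOfEmb (closureEmb (K := ℚ) (v₂.adicCompletion ℚ)))))
        (hγᵥ : κ.IsTopGenerator (resGalOfEmb (closureEmb (K := ℚ) (v₂.adicCompletion ℚ)) γᵥ))
        (I : IwasawaH1Data W 2 κ γ) (J : LocalIwasawaH1Data κ v₂ ((tateRep W 2).toLocal v₂) γᵥ)
        (J' : LocalIwasawaH1Data κ v₂ (tateLocalOrdinaryRep W 2 v₂) γᵥ),
      ∃ col : J.H →ₗ[IwasawaAlgebra 2] IwasawaAlgebra 2,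
        (∀ x : J.H, col x = 0 → x ∈ LinearMap.range (J'.ordinaryInclusion J)) ∧
        ∃ g : I.H, IsEulerSystemClassTwo W hκ I g ∧ col (I.loc J hsurj hγ hγᵥ g) ∉ IwasawaAlgebra.augIdealP 2 := by
  intro W _ _ _ _ _ N _ f κ γ hκ hγ hΔ hord h2 hγ' hf v₂ hv₂ γᵥ hsurj hγᵥ I J J'
  obtain ⟨col, hker, g, hg, u, M, L', r, hM, hr, hL', hcol⟩ :=
    hcolERL W f κ γ hκ hγ hΔ hord h2 hγ' hf v₂ hv₂ γᵥ hsurj hγᵥ I J J'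
  have hμ : ∃ n : ℕ, ‖PowerSeries.coeff n (padicLFunction f (unitRoot W 2 : ℚ_[2]))‖ = 1 :=
    AnalyticMuTwo.exists_norm_coeff_padicLFunction_two_eq_one_of_surj W hord h2 hf
  exact ⟨col, hker, g, hg, notMem_augIdealP_of_colemanValue u hM hr hL' hμ hcol⟩

/-- **V⁺ ⟹ W2⁺** (`0 < Δ`, one global class): the value-only text «∃ `col` with `ker col ≤ range(J′ → J)` and a class `y ∈ 𝐇¹_Γ` with
`col (loc y) ∉ (2)`» implies the registered text of `stub_colemanHalf_posDisc_two` (= `hcolHalfPos` of p723623), by the same rescaling.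
[cite: MazurTateTeitelbaum1986Invent, §I.12] [cite: RohrlichInventiones1984, Theorem (p. 409)]
[cite: Kato2004Asterisque, Thm 12.5 (1) (p. 221), Thm 16.6 (2) (p. 271), Prop 17.11 (p. 277) (shape of W2⁺)] -/
theorem colemanHalf_posDisc_two_of_muFreeValue
    (hV : ∀ (W : WeierstrassCurve ℚ) [W.IsElliptic] [W.IsGloballyMinimal]
      [ContinuousSMul ℤ_[2] (W.tateModule 2)] [Module.Free ℤ_[2] (W.tateModule 2)] [Module.Finite ℤ_[2] (W.tateModule 2)]
      {N : ℕ} [NeZero N] (f : CuspForm (Gamma0 N) 2)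
      (κ : ZpExtension ℚ 2) (γ : absoluteGaloisGroup ℚ) (hκ : κ.IsCyclotomic) (hγ : κ.IsTopGenerator γ),
      0 < W.Δ → IsOrdinaryAt W 2 → W.HasSurjectiveModNGaloisRep 2 → IsCyclotomicVariable 2 γ → IsNewformOf W f →
      ∀ (v₂ : HeightOneSpectrum (𝓞 ℚ)) (_ : ((2 : ℕ) : 𝓞 ℚ) ∈ v₂.asIdeal)
        (γᵥ : absoluteGaloisGroup (v₂.adicCompletion ℚ))
        (hsurj : Function.Surjective
          (κ.toContinuousMonoidHom.comp (resGalOfEmb (closureEmb (K := ℚ) (v₂.adicCompletion ℚ)))))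
        (hγᵥ : κ.IsTopGenerator (resGalOfEmb (closureEmb (K := ℚ) (v₂.adicCompletion ℚ)) γᵥ))
        (I : IwasawaH1Data W 2 κ γ) (J : LocalIwasawaH1Data κ v₂ ((tateRep W 2).toLocal v₂) γᵥ)
        (J' : LocalIwasawaH1Data κ v₂ (tateLocalOrdinaryRep W 2 v₂) γᵥ),
      ∃ col : J.H →ₗ[IwasawaAlgebra 2] IwasawaAlgebra 2,
        (∀ x : J.H, col x = 0 → x ∈ LinearMap.range (J'.ordinaryInclusion J)) ∧
        ∃ y : I.H, col (I.loc J hsurj hγ hγᵥ y) ∉ IwasawaAlgebra.augIdealP 2) :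
    ∀ (W : WeierstrassCurve ℚ) [W.IsElliptic] [W.IsGloballyMinimal]
      [ContinuousSMul ℤ_[2] (W.tateModule 2)] [Module.Free ℤ_[2] (W.tateModule 2)] [Module.Finite ℤ_[2] (W.tateModule 2)]
      {N : ℕ} [NeZero N] (f : CuspForm (Gamma0 N) 2)
      (κ : ZpExtension ℚ 2) (γ : absoluteGaloisGroup ℚ) (hκ : κ.IsCyclotomic) (hγ : κ.IsTopGenerator γ),
      0 < W.Δ → IsOrdinaryAt W 2 → W.HasSurjectiveModNGaloisRep 2 → IsCyclotomicVariable 2 γ → IsNewformOf W f →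
      ∀ (v₂ : HeightOneSpectrum (𝓞 ℚ)) (_ : ((2 : ℕ) : 𝓞 ℚ) ∈ v₂.asIdeal)
        (γᵥ : absoluteGaloisGroup (v₂.adicCompletion ℚ))
        (hsurj : Function.Surjective
          (κ.toContinuousMonoidHom.comp (resGalOfEmb (closureEmb (K := ℚ) (v₂.adicCompletion ℚ)))))
        (hγᵥ : κ.IsTopGenerator (resGalOfEmb (closureEmb (K := ℚ) (v₂.adicCompletion ℚ)) γᵥ))
        (I : IwasawaH1Data W 2 κ γ) (J : LocalIwasawaH1Data κ v₂ ((tateRep W 2).toLocal v₂) γᵥ)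
        (J' : LocalIwasawaH1Data κ v₂ (tateLocalOrdinaryRep W 2 v₂) γᵥ),
      ∃ col : J.H →ₗ[IwasawaAlgebra 2] IwasawaAlgebra 2,
        (∀ x : J.H, col x = 0 → x ∈ LinearMap.range (J'.ordinaryInclusion J)) ∧
        ∃ (y : I.H) (u : (IwasawaAlgebra 2)ˣ) (M L' : IwasawaAlgebra 2) (r : ℚ_[2]),
            M ∉ IwasawaAlgebra.augIdealP 2 ∧ ‖r‖ = 1 ∧
              iwasawaToPowerSeries 2 L' = PowerSeries.C r * padicLFunction f (unitRoot W 2 : ℚ_[2]) ∧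
              col (I.loc J hsurj hγ hγᵥ y) = (u : IwasawaAlgebra 2) * M * L' := by
  intro W _ _ _ _ _ N _ f κ γ hκ hγ hΔ hord h2 hγ' hf v₂ hv₂ γᵥ hsurj hγᵥ I J J'
  obtain ⟨col, hker, y, hval⟩ := hV W f κ γ hκ hγ hΔ hord h2 hγ' hf v₂ hv₂ γᵥ hsurj hγᵥ I J J'
  obtain ⟨L', hL'⟩ := exists_iwasawaToPowerSeries_eq_padicLFunction_two_auto hord hf
  have hL'0 : L' ≠ 0 := by
    rintro rfl
    exact padicLFunction_unitRoot_ne_zero hord hf (by rw [← hL', map_zero])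
  obtain ⟨col', hker', u, M, hM, hcol'⟩ :=
    exists_rescaled_col_of_notMem_augIdealP (LinearMap.range (J'.ordinaryInclusion J)) col hker
      (I.loc J hsurj hγ hγᵥ y) hval hL'0
  exact ⟨col', hker', y, u, M, L', 1, hM, norm_one, by rw [map_one, one_mul, hL'], hcol'⟩

/-- **W2⁺ ⟹ V⁺** (`0 < Δ`): the registered text implies the value-only one (prime `(2)`, `u·M ∉ (2)`, `L′ ∉ (2)` by the PROVED analytic
`μ₂ = 0` on the cell). So V⁺ is NOT a strengthening of W2⁺. [cite: Washington1997, §13.1]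
[cite: GreenbergLNM1716, §1 Conj. 1.11 (shape; the p = 2 analytic reading is the tree's theorem)] -/
theorem muFreeValue_of_colemanHalf_posDisc_two
    (hcolHalfPos : ∀ (W : WeierstrassCurve ℚ) [W.IsElliptic] [W.IsGloballyMinimal]
      [ContinuousSMul ℤ_[2] (W.tateModule 2)] [Module.Free ℤ_[2] (W.tateModule 2)] [Module.Finite ℤ_[2] (W.tateModule 2)]
      {N : ℕ} [NeZero N] (f : CuspForm (Gamma0 N) 2)
      (κ : ZpExtension ℚ 2) (γ : absoluteGaloisGroup ℚ) (hκ : κ.IsCyclotomic) (hγ : κ.IsTopGenerator γ),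
      0 < W.Δ → IsOrdinaryAt W 2 → W.HasSurjectiveModNGaloisRep 2 → IsCyclotomicVariable 2 γ → IsNewformOf W f →
      ∀ (v₂ : HeightOneSpectrum (𝓞 ℚ)) (_ : ((2 : ℕ) : 𝓞 ℚ) ∈ v₂.asIdeal)
        (γᵥ : absoluteGaloisGroup (v₂.adicCompletion ℚ))
        (hsurj : Function.Surjective
          (κ.toContinuousMonoidHom.comp (resGalOfEmb (closureEmb (K := ℚ) (v₂.adicCompletion ℚ)))))
        (hγᵥ : κ.IsTopGenerator (resGalOfEmb (closureEmb (K := ℚ) (v₂.adicCompletion ℚ)) γᵥ))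
        (I : IwasawaH1Data W 2 κ γ) (J : LocalIwasawaH1Data κ v₂ ((tateRep W 2).toLocal v₂) γᵥ)
        (J' : LocalIwasawaH1Data κ v₂ (tateLocalOrdinaryRep W 2 v₂) γᵥ),
      ∃ col : J.H →ₗ[IwasawaAlgebra 2] IwasawaAlgebra 2,
        (∀ x : J.H, col x = 0 → x ∈ LinearMap.range (J'.ordinaryInclusion J)) ∧
        ∃ (y : I.H) (u : (IwasawaAlgebra 2)ˣ) (M L' : IwasawaAlgebra 2) (r : ℚ_[2]),
            M ∉ IwasawaAlgebra.augIdealP 2 ∧ ‖r‖ = 1 ∧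
              iwasawaToPowerSeries 2 L' = PowerSeries.C r * padicLFunction f (unitRoot W 2 : ℚ_[2]) ∧
              col (I.loc J hsurj hγ hγᵥ y) = (u : IwasawaAlgebra 2) * M * L') :
    ∀ (W : WeierstrassCurve ℚ) [W.IsElliptic] [W.IsGloballyMinimal]
      [ContinuousSMul ℤ_[2] (W.tateModule 2)] [Module.Free ℤ_[2] (W.tateModule 2)] [Module.Finite ℤ_[2] (W.tateModule 2)]
      {N : ℕ} [NeZero N] (f : CuspForm (Gamma0 N) 2)
      (κ : ZpExtension ℚ 2) (γ : absoluteGaloisGroup ℚ) (hκ : κ.IsCyclotomic) (hγ : κ.IsTopGenerator γ),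
      0 < W.Δ → IsOrdinaryAt W 2 → W.HasSurjectiveModNGaloisRep 2 → IsCyclotomicVariable 2 γ → IsNewformOf W f →
      ∀ (v₂ : HeightOneSpectrum (𝓞 ℚ)) (_ : ((2 : ℕ) : 𝓞 ℚ) ∈ v₂.asIdeal)
        (γᵥ : absoluteGaloisGroup (v₂.adicCompletion ℚ))
        (hsurj : Function.Surjective
          (κ.toContinuousMonoidHom.comp (resGalOfEmb (closureEmb (K := ℚ) (v₂.adicCompletion ℚ)))))
        (hγᵥ : κ.IsTopGenerator (resGalOfEmb (closureEmb (K := ℚ) (v₂.adicCompletion ℚ)) γᵥ))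
        (I : IwasawaH1Data W 2 κ γ) (J : LocalIwasawaH1Data κ v₂ ((tateRep W 2).toLocal v₂) γᵥ)
        (J' : LocalIwasawaH1Data κ v₂ (tateLocalOrdinaryRep W 2 v₂) γᵥ),
      ∃ col : J.H →ₗ[IwasawaAlgebra 2] IwasawaAlgebra 2,
        (∀ x : J.H, col x = 0 → x ∈ LinearMap.range (J'.ordinaryInclusion J)) ∧
        ∃ y : I.H, col (I.loc J hsurj hγ hγᵥ y) ∉ IwasawaAlgebra.augIdealP 2 := by
  intro W _ _ _ _ _ N _ f κ γ hκ hγ hΔ hord h2 hγ' hf v₂ hv₂ γᵥ hsurj hγᵥ I J J'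
  obtain ⟨col, hker, y, u, M, L', r, hM, hr, hL', hcol⟩ :=
    hcolHalfPos W f κ γ hκ hγ hΔ hord h2 hγ' hf v₂ hv₂ γᵥ hsurj hγᵥ I J J'
  have hμ : ∃ n : ℕ, ‖PowerSeries.coeff n (padicLFunction f (unitRoot W 2 : ℚ_[2]))‖ = 1 :=
    AnalyticMuTwo.exists_norm_coeff_padicLFunction_two_eq_one_of_surj W hord h2 hf
  exact ⟨col, hker, y, notMem_augIdealP_of_colemanValue u hM hr hL' hμ hcol⟩

/-! ## §3 Doors BY NAME: F1μι⁻ and P⁺ from the Tate-duality fact (all `p`, read at `2`) and the value-only texts -/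

/-- **F1μι⁻ = `ZetaColemanMuIotaNegDiscAtTwo` (conjunct 1 of child 24097) BY NAME from the Literature fact
`Kato2004.exists_lambdaAdicLocalTatePairing_selmer_orthogonal` (PRINT-COMPOSITE, every `p`; read at `2` = `stub_tateDualityTower 2`) and the
value-only text V⁻** — one application of w3 g3's `zetaColemanMuIotaNegDiscAtTwo_of_katoCarriers` (p720644) to `hPT 2` and `colemanERL_negDisc_two_of_muFreeValue hV`.
CONDITIONAL; nothing closed. [cite: MilneADT2006, Ch. I Cor. 2.3 and Thm. 4.10] [cite: GreenbergLNM1716, §2 Prop. 2.2 (p. 73), p. 122]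
[cite: Kato2004Asterisque, Thm 12.6 (p. 222), Thm 16.6 (2) (p. 271), §17.13 (pp. 279–280)] -/
theorem zetaColemanMuIotaNegDiscAtTwo_of_tateDuality_of_muFreeValue
    (hPT : exists_lambdaAdicLocalTatePairing_selmer_orthogonal)
    (hV : ∀ (W : WeierstrassCurve ℚ) [W.IsElliptic] [W.IsGloballyMinimal]
      [ContinuousSMul ℤ_[2] (W.tateModule 2)] [Module.Free ℤ_[2] (W.tateModule 2)] [Module.Finite ℤ_[2] (W.tateModule 2)]
      {N : ℕ} [NeZero N] (f : CuspForm (Gamma0 N) 2)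
      (κ : ZpExtension ℚ 2) (γ : absoluteGaloisGroup ℚ) (hκ : κ.IsCyclotomic) (hγ : κ.IsTopGenerator γ),
      W.Δ < 0 → IsOrdinaryAt W 2 → W.HasSurjectiveModNGaloisRep 2 → IsCyclotomicVariable 2 γ → IsNewformOf W f →
      ∀ (v₂ : HeightOneSpectrum (𝓞 ℚ)) (_ : ((2 : ℕ) : 𝓞 ℚ) ∈ v₂.asIdeal)
        (γᵥ : absoluteGaloisGroup (v₂.adicCompletion ℚ))
        (hsurj : Function.Surjective
          (κ.toContinuousMonoidHom.comp (resGalOfEmb (closureEmb (K := ℚ) (v₂.adicCompletion ℚ)))))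
        (hγᵥ : κ.IsTopGenerator (resGalOfEmb (closureEmb (K := ℚ) (v₂.adicCompletion ℚ)) γᵥ))
        (I : IwasawaH1Data W 2 κ γ) (J : LocalIwasawaH1Data κ v₂ ((tateRep W 2).toLocal v₂) γᵥ)
        (J' : LocalIwasawaH1Data κ v₂ (tateLocalOrdinaryRep W 2 v₂) γᵥ),
      ∃ col : J.H →ₗ[IwasawaAlgebra 2] IwasawaAlgebra 2,
        (∀ x : J.H, col x = 0 → x ∈ LinearMap.range (J'.ordinaryInclusion J)) ∧
        ∃ g : I.H, IsEulerSystemClassTwo W hκ I g ∧ col (I.loc J hsurj hγ hγᵥ g) ∉ IwasawaAlgebra.augIdealP 2) :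
    ZetaColemanMuIotaNegDiscAtTwo :=
  zetaColemanMuIotaNegDiscAtTwo_of_katoCarriers (hPT 2) (colemanERL_negDisc_two_of_muFreeValue hV)

/-- **P⁺ = `ColemanMuSpanFreeIotaPosDiscAtTwo` BY NAME from the same Literature fact read at `2` and the value-only text V⁺** — one
application of the lead g9's `colemanMuSpanFreeIotaPosDiscAtTwo_of_katoCarriers` (p723623) to `hPT 2` and `colemanHalf_posDisc_two_of_muFreeValue hV`.
CONDITIONAL; nothing closed. [cite: MilneADT2006, Ch. I Cor. 2.3 and Thm. 4.10] [cite: GreenbergLNM1716, §2 Prop. 2.2 (p. 73), p. 122, Conj. 1.11 (shape)]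
[cite: Kato2004Asterisque, Thm 12.5 (1) (p. 221), Thm 16.6 (2) (p. 271), §17.13 (pp. 279–280)] -/
theorem colemanMuSpanFreeIotaPosDiscAtTwo_of_tateDuality_of_muFreeValue
    (hPT : exists_lambdaAdicLocalTatePairing_selmer_orthogonal)
    (hV : ∀ (W : WeierstrassCurve ℚ) [W.IsElliptic] [W.IsGloballyMinimal]
      [ContinuousSMul ℤ_[2] (W.tateModule 2)] [Module.Free ℤ_[2] (W.tateModule 2)] [Module.Finite ℤ_[2] (W.tateModule 2)]
      {N : ℕ} [NeZero N] (f : CuspForm (Gamma0 N) 2)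
      (κ : ZpExtension ℚ 2) (γ : absoluteGaloisGroup ℚ) (hκ : κ.IsCyclotomic) (hγ : κ.IsTopGenerator γ),
      0 < W.Δ → IsOrdinaryAt W 2 → W.HasSurjectiveModNGaloisRep 2 → IsCyclotomicVariable 2 γ → IsNewformOf W f →
      ∀ (v₂ : HeightOneSpectrum (𝓞 ℚ)) (_ : ((2 : ℕ) : 𝓞 ℚ) ∈ v₂.asIdeal)
        (γᵥ : absoluteGaloisGroup (v₂.adicCompletion ℚ))
        (hsurj : Function.Surjective
          (κ.toContinuousMonoidHom.comp (resGalOfEmb (closureEmb (K := ℚ) (v₂.adicCompletion ℚ)))))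
        (hγᵥ : κ.IsTopGenerator (resGalOfEmb (closureEmb (K := ℚ) (v₂.adicCompletion ℚ)) γᵥ))
        (I : IwasawaH1Data W 2 κ γ) (J : LocalIwasawaH1Data κ v₂ ((tateRep W 2).toLocal v₂) γᵥ)
        (J' : LocalIwasawaH1Data κ v₂ (tateLocalOrdinaryRep W 2 v₂) γᵥ),
      ∃ col : J.H →ₗ[IwasawaAlgebra 2] IwasawaAlgebra 2,
        (∀ x : J.H, col x = 0 → x ∈ LinearMap.range (J'.ordinaryInclusion J)) ∧
        ∃ y : I.H, col (I.loc J hsurj hγ hγᵥ y) ∉ IwasawaAlgebra.augIdealP 2) :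
    ColemanMuSpanFreeIotaPosDiscAtTwo :=
  colemanMuSpanFreeIotaPosDiscAtTwo_of_katoCarriers (hPT 2) (colemanHalf_posDisc_two_of_muFreeValue hV)

end Summit.BirchSwinnertonDyer.BirchSwinnertonDyer.Theorems.SteinbergFibreAtTwo

end
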